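/-
Copyright: the b2b-balaban T⁴-continuum CRUX team, row NE7b owner lineage `t4-ne7b-p1` (gen 112). Project licence.
-/
import Literature.MathematicalPhysics.QuantumFieldTheory.Balaban1983to89.B6QGQFourier275Zd
import Literature.MathematicalPhysics.QuantumFieldTheory.Balaban1983to89.B5Hk165L2Zd
import Literature.MathematicalPhysics.QuantumFieldTheory.Balaban1983to89.B4Eq246SquareSummable

/-!
# THE ONE-SHOT CHART OF THE FREE FIELD, FOURIER FORM: the scalar `H = G′Q′*(Q′G′Q′*)⁻¹` of [B5] (1.103) on the whole
# lattice `ℤ^d` IS the lattice kernel of the multiplier `Gfull(z;p′)∕(Q′G′Q′*)~(p′)` —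
# `H(z, y) = (2π)^{−d} ∫_{[−π,π]^d} Gfull(z;p′) e^{−ip′·y} ∕ (Q′G′Q′*)~(p′) dp′` for every fine site `z`, every block `y`,
# every block side `n + 1 ≥ 1`, every `a > 0` (row NE7b, node U5c; Literature B4∕B5∕B6 columns + Mathlib; [folklore] bookkeeping)

Cell `pub-balaban`, sub-cell `t4`, spine estimate NE7b (`T4WeightBudget.RelWeightBound`; the cell's OWN estimate — NOT PRINTED in
[Bałaban 1983–89], NOT PROVED).  Crux-route work under `Spine/NE7b/` by the row OWNER (`t4-ne7b-p1` gen 112) under FREEZE (0)'s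
crux-prover clause (RULING W-ne7bp1-g112-1: the owner takes the PLANCHEREL JUNCTION of CLAIM C-ne7bp1-g111-1); NOTHING of Bałaban's is
asserted; no `T4Continuum/Support` leaf typed; no `def`; zero `sorry`.  Imports: the scalar whole-lattice `ℤ^d` column of the
Literature (`B6QGQFourier275Zd` ⊇ `B4Green244`, `B5Hk103ScalarZd`; `B5Hk165L2Zd`; `B4Eq246SquareSummable` for Bessel).

WHY.  The desk's fibre formula for the one-shot chart (`M^{−d}‖H_M B‖² = ∫(S₂∕S²)|B̂|²`, PRICING-NE7b v120 F713) needs the FOURIER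
REPRESENTATION of the tree's operator `H` (`B5Hk103ScalarZd.kerH n a`, the pv23 kernel of `G′Q′*(Q′G′Q′*)⁻¹` built from B4-Sect.-5
inverse kernels on `ℤ^d`).  The column already has `G′Q′* = K` (the (2.48) kernel: `B6QGQFourier275Zd.K_eq_gq`, multiplier
`B4Green244.Gfull`) and `Q′G′Q′* = (2π)^{−d}∫e^{ip′·(y−y′)}(2.75)` (`kerQGQ_eq_latticeKernel`, multiplier `symbQGQ`); the inverse
`(Q′G′Q′*)⁻¹ = limInv` and the series `H = Σ′ (G′Q′*)·(Q′G′Q′*)⁻¹` had no Fourier form.  Instead of a convolution theorem (which needs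
Parseval on `T^d`) this file identifies the candidate field `φ(z) = (2π)^{−d}∫ Gfull(z;p′)e^{−ip′·y₀}∕symbQGQ(p′)dp′` with the column
`H(·, y₀)` through the tree's UNIQUENESS theorem `B5Hk165L2Zd.eq_HBZd_of_weakEL` («a square-summable fine field with block sums
`(n+1)^d·B` satisfying the weak Euler–Lagrange equation IS `H B`»): (i) block sums — `Q′Gfull(·;p′) = e^{ip′·y}symbQGQ(p′)`
(`sum_Gfull_finePt`), so `Q′φ = δ_{y₀}`; (ii) weak Euler–Lagrange — `−Δ^ξ Gfull(·;p′) = e^{ip′·⌊z∕N⌋}(1 − a·symbQGQ(p′))`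
(`opD_Gfull`) is constant on blocks, so `⟨Δ^η A′, φ⟩ = 0` whenever `Q′A′ = 0` (`sum_mul_blockConst_eq_zero`); (iii) square-summability
— block row by block row `φ` is the lattice kernel of the continuous multiplier `G_τ∕symbQGQ` (`Gfull_finePt`), Bessel
(`B4Eq246SquareSummable.summable_normSq_latticeKernel`).  The same three facts for the imaginary part (with `B = 0`) show it
vanishes.

WHAT IS PROVED ([folklore] bookkeeping on the column's objects; `n : ℕ`, `N = n + 1`, `a > 0`, `y₀ ∈ ℤ^d`):
* §1 the multiplier on the zone: `symbQGQ_ne_zero`, `continuousOn_Gfull_div`, `continuousOn_G_div`, `integrableOn_integrand_of_continuousOn`.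
* §2 the candidate field `φ(z) = latticeKernel (Gfull(z;·)∕symbQGQ) (−y₀)`: row form `phi_chart` (`φ(chart n x τ) =
  latticeKernel (G_τ∕symbQGQ)(x − y₀)`), `summable_normSq_phi` (Bessel, block row by block row).
* §3 `sum_B_phi`: `Σ_{z∈B(y)} φ(z) = N^d·δ_{y,y₀}`.
* §4 `negLap_phi`: `−Δ^ξφ` is the lattice kernel of a block phase, hence block-constant; `weakEL_phi_re ∕ _im`.
* §5 **`kerH_eq_latticeKernel`** — THE HEADLINE: `(kerH n a z y₀ : ℂ) = latticeKernel (fun P => Gfull (n+1) a 0 z P ∕ symbQGQ (n+1) a P) (−y₀)`;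
  **`kerH_chart_eq_latticeKernel`**: `kerH n a (chart n x τ) y₀ = latticeKernel (G_{N,a,0,τ}∕symbQGQ)(x − y₀)` (the alias ∕ offset
  form — [B5] (1.63) read on `ℤ^d` for the scalar column).

NOT HERE (honest): the norm bound `N^{−d}Σ_z(HB)(z)² ≤ (π²∕4)^d Σ_y B(y)²` (file (42) of the road, with (40) `OneShotChartFibreSum`);
anything of Bałaban's vector ∕ covariant `H_k` ((A3), NC-NE7b-α UNRULED); the torus.  BY-NAME EFFECT ON THE WALL: NONE.  NE7b NOT PRINTED ∕
NOT PROVED; spine PROVED 0∕9; rung (B)+1 on a FINITE torus — NOT infinite volume, NOT the mass gap, NOT Clay.  HONEST DEPENDENCY: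
continuum YM on T⁴ ⇐ BetaPertH ∧ nine spine estimates (0∕9 proved); BetaPertH ⇐ (D1) ∧ (D4) ∧ CAP+tail.
-/

set_option autoImplicit false

namespace Summit.QuantumFields.BalabanUV.T4Continuum.NE7b.OneShotChartFourier

open Finset Complex MeasureTheory
open Literature.MathematicalPhysics.QuantumFieldTheory.Balaban1983to89
open B4Strip (ofRealVec)
open B4StripSums (G differentiableAt_G)
open B4ContourShift (BZ latticeKernel integrand continuous_ofRealVec)
open B4Green242Bridge (latticeKernel_const_mul)
open B4Green244 (Gfull Gfull_finePt opD negLap blockAvg opD_Gfull opD_latticeKernel latticeKernel_phase_mul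
  latticeKernel_congr latticeKernel_sum_mul latticeKernel_phase finePt coarse phaseC differentiableAt_Gfull E_ne_zero_BZ
  ofRealVec_mem_Fat)
open B6QGQLower276 (X B blk chart e mem_B)
open B5Hk103ScalarZd (kerH nbhd lapKer_eq_zero_of_not_mem sum_mul_blockConst_eq_zero)
open B5Hk103Unique (WeakEL lapRow summable_lapKer_mul tsum_lapKer_mul')
open B5Hk165L2Zd (HBZd eq_HBZd_of_weakEL)
open B5Momentum166Zd (isCompact_BZ)
open B6QGQFourier275Zd (symbQGQ symbQGQ_ofReal symbR symbR_ge twoGamma0_pos sum_Gfull_finePt continuousOn_symbQGQ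
  continuous_cexp_phase sum_B_eq finePt_succ coarse_succ)
open B4Eq246SquareSummable (summable_normSq_latticeKernel)
open scoped Real

noncomputable section

variable {d : ℕ}

/-! ## §1. The multiplier `Gfull(z;·)∕symbQGQ` on the real zone -/

/-- `(Q′G′Q′*)~(p′) ≠ 0` on the zone (`≥ 2γ₀ > 0`). [folklore] -/
theorem symbQGQ_ne_zero (n : ℕ) {a : ℝ} (ha : 0 < a) (p : Fin d → ℝ) (hp : p ∈ BZ d) :
    symbQGQ (n + 1) a (ofRealVec p) ≠ 0 := by
  rw [symbQGQ_ofReal]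
  have h : 0 < symbR (n + 1) a p := lt_of_lt_of_le (twoGamma0_pos d ha) (symbR_ge (n + 1) (by omega) ha p hp)
  exact_mod_cast h.ne'

/-- the full multiplier divided by `symbQGQ` is continuous on the zone. [folklore] -/
theorem continuousOn_Gfull_div (n : ℕ) {a : ℝ} (ha : 0 < a) (z : X d) :
    ContinuousOn (fun p : Fin d → ℝ => Gfull (n + 1) a 0 z (ofRealVec p) / symbQGQ (n + 1) a (ofRealVec p)) (BZ d) := by
  refine ContinuousOn.div (fun p hp => ?_) (continuousOn_symbQGQ (n + 1) (by omega) ha) (symbQGQ_ne_zero n ha)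
  exact ((differentiableAt_Gfull (n + 1) (by omega) a 0 ha le_rfl z p hp).continuousAt.comp
    continuous_ofRealVec.continuousAt).continuousWithinAt

/-- the block-offset multiplier divided by `symbQGQ` is continuous on the zone. [folklore] -/
theorem continuousOn_G_div (n : ℕ) {a : ℝ} (ha : 0 < a) (τ : Fin d → Fin (n + 1)) :
    ContinuousOn (fun p : Fin d → ℝ => G (n + 1) a 0 τ (ofRealVec p) / symbQGQ (n + 1) a (ofRealVec p)) (BZ d) := by
  refine ContinuousOn.div (fun p hp => ?_) (continuousOn_symbQGQ (n + 1) (by omega) ha) (symbQGQ_ne_zero n ha)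
  have hd := differentiableAt_G (n + 1) a 0 le_rfl (r := 0) (by norm_num) (by norm_num) (ofRealVec_mem_Fat p hp)
    (E_ne_zero_BZ (n + 1) (by omega) a 0 ha le_rfl p hp) τ
  exact (hd.continuousAt.comp continuous_ofRealVec.continuousAt).continuousWithinAt

/-- a multiplier continuous on the (compact) zone has an integrable lattice-kernel integrand. [folklore] -/
theorem integrableOn_integrand_of_continuousOn {f : (Fin d → ℂ) → ℂ}
    (h : ContinuousOn (fun p : Fin d → ℝ => f (ofRealVec p)) (BZ d)) (x : X d) : IntegrableOn (integrand f x) (BZ d) :=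
  (h.mul (continuous_cexp_phase x).continuousOn).integrableOn_compact isCompact_BZ

/-! ## §2. The candidate field `φ(z) = (2π)^{−d}∫ Gfull(z;p′) e^{−ip′·y₀} ∕ symbQGQ(p′) dp′`: row form and square-summability -/

/-- **Row form**: at the fine site `chart n x τ` the candidate field is the lattice kernel of `G_τ∕symbQGQ` read at `x − y₀` (the block
phase `e^{ip′·x}` of `Gfull` shifts the evaluation point). [folklore] -/
theorem phi_chart (n : ℕ) (a : ℝ) (y₀ x : X d) (τ : Fin d → Fin (n + 1)) :
    latticeKernel (fun P => Gfull (n + 1) a 0 (chart n x τ) P / symbQGQ (n + 1) a P) (-y₀)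
      = latticeKernel (fun P => G (n + 1) a 0 τ P / symbQGQ (n + 1) a P) (x - y₀) := by
  have h : (fun P => Gfull (n + 1) a 0 (chart n x τ) P / symbQGQ (n + 1) a P)
      = fun P => cexp (I * phaseC P x) * (G (n + 1) a 0 τ P / symbQGQ (n + 1) a P) := by
    funext P
    rw [← finePt_succ, Gfull_finePt, mul_div_assoc]
  rw [h, latticeKernel_phase_mul, neg_add_eq_sub]

/-- each block row of the candidate field is square-summable (Bessel for the continuous multiplier `G_τ∕symbQGQ`). [folklore] -/
theorem summable_normSq_phi_row (n : ℕ) {a : ℝ} (ha : 0 < a) (y₀ : X d) (τ : Fin d → Fin (n + 1)) :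
    Summable fun x : X d =>
      ‖latticeKernel (fun P => Gfull (n + 1) a 0 (chart n x τ) P / symbQGQ (n + 1) a P) (-y₀)‖ ^ 2 := by
  simp_rw [phi_chart]
  have h := summable_normSq_latticeKernel (Gm := fun P => G (n + 1) a 0 τ P / symbQGQ (n + 1) a P)
    (continuousOn_G_div n ha τ)
  have h2 : (fun x : X d => ‖latticeKernel (fun P => G (n + 1) a 0 τ P / symbQGQ (n + 1) a P) (x - y₀)‖ ^ 2)
      = (fun x : X d => ‖latticeKernel (fun P => G (n + 1) a 0 τ P / symbQGQ (n + 1) a P) x‖ ^ 2)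
        ∘ (Equiv.subRight y₀) := by
    funext x; rfl
  rw [h2]
  exact (Equiv.subRight y₀).summable_iff.mpr h

/-- **the candidate field is square-summable over the fine lattice** (block row by block row). [folklore] -/
theorem summable_normSq_phi (n : ℕ) {a : ℝ} (ha : 0 < a) (y₀ : X d) :
    Summable fun z : X d => ‖latticeKernel (fun P => Gfull (n + 1) a 0 z P / symbQGQ (n + 1) a P) (-y₀)‖ ^ 2 := by
  rw [← (B5Hk103ScalarZd.blockEquiv (d := d) n).summable_iff]
  have h3 : (fun z : X d => ‖latticeKernel (fun P => Gfull (n + 1) a 0 z P / symbQGQ (n + 1) a P) (-y₀)‖ ^ 2)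
        ∘ (B5Hk103ScalarZd.blockEquiv (d := d) n)
      = fun yτ : X d × (Fin d → Fin (n + 1)) =>
        ‖latticeKernel (fun P => Gfull (n + 1) a 0 (chart n yτ.1 yτ.2) P / symbQGQ (n + 1) a P) (-y₀)‖ ^ 2 := by
    funext yτ; rfl
  rw [h3]
  refine (summable_prod_of_nonneg (fun yτ => sq_nonneg _)).mpr ⟨fun y => (hasSum_fintype _).summable, ?_⟩
  simp_rw [tsum_fintype]
  exact summable_sum fun τ _ => summable_normSq_phi_row n ha y₀ τ

/-- real parts of the candidate field are square-summable. [folklore] -/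
theorem summable_sq_phi_re (n : ℕ) {a : ℝ} (ha : 0 < a) (y₀ : X d) :
    Summable fun z : X d => (latticeKernel (fun P => Gfull (n + 1) a 0 z P / symbQGQ (n + 1) a P) (-y₀)).re ^ 2 := by
  refine (summable_normSq_phi n ha y₀).of_nonneg_of_le (fun z => sq_nonneg _) fun z => ?_
  rw [← Complex.normSq_eq_norm_sq]
  nlinarith [Complex.normSq_apply (latticeKernel (fun P => Gfull (n + 1) a 0 z P / symbQGQ (n + 1) a P) (-y₀)),
    sq_nonneg (latticeKernel (fun P => Gfull (n + 1) a 0 z P / symbQGQ (n + 1) a P) (-y₀)).im]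

/-- imaginary parts of the candidate field are square-summable. [folklore] -/
theorem summable_sq_phi_im (n : ℕ) {a : ℝ} (ha : 0 < a) (y₀ : X d) :
    Summable fun z : X d => (latticeKernel (fun P => Gfull (n + 1) a 0 z P / symbQGQ (n + 1) a P) (-y₀)).im ^ 2 := by
  refine (summable_normSq_phi n ha y₀).of_nonneg_of_le (fun z => sq_nonneg _) fun z => ?_
  rw [← Complex.normSq_eq_norm_sq]
  nlinarith [Complex.normSq_apply (latticeKernel (fun P => Gfull (n + 1) a 0 z P / symbQGQ (n + 1) a P) (-y₀)),
    sq_nonneg (latticeKernel (fun P => Gfull (n + 1) a 0 z P / symbQGQ (n + 1) a P) (-y₀)).re]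

/-! ## §3. Block sums: `Q′φ = δ_{y₀}` -/

/-- **`Σ_{z∈B(y)} φ(z) = (n+1)^d·δ_{y,y₀}`**: the block sum of `Gfull(·;p′)` is `N^d e^{ip′·y} symbQGQ(p′)` (`sum_Gfull_finePt`), the
multiplier cancels, and `(2π)^{−d}∫e^{ip′·(y−y₀)}dp′ = δ`. [folklore] -/
theorem sum_B_phi (n : ℕ) {a : ℝ} (ha : 0 < a) (y₀ y : X d) :
    ∑ z ∈ B n y, latticeKernel (fun P => Gfull (n + 1) a 0 z P / symbQGQ (n + 1) a P) (-y₀)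
      = (((n + 1 : ℕ) : ℂ) ^ d) * (if y = y₀ then 1 else 0) := by
  have hint : ∀ j ∈ (Finset.univ : Finset (Fin d → Fin (n + 1))),
      IntegrableOn (integrand (fun P => Gfull (n + 1) a 0 (chart n y j) P / symbQGQ (n + 1) a P) (-y₀)) (BZ d) :=
    fun j _ => integrableOn_integrand_of_continuousOn (continuousOn_Gfull_div n ha _) _
  have h1 := latticeKernel_sum_mul Finset.univ (fun _ => (1 : ℂ))
    (fun j => fun P => Gfull (n + 1) a 0 (chart n y j) P / symbQGQ (n + 1) a P) (-y₀) hint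
  simp only [one_mul] at h1
  rw [sum_B_eq, ← h1]
  have h2 : ∀ p ∈ BZ d, (∑ j : Fin d → Fin (n + 1),
        Gfull (n + 1) a 0 (chart n y j) (ofRealVec p) / symbQGQ (n + 1) a (ofRealVec p))
      = (((n + 1 : ℕ) : ℂ) ^ d) * cexp (I * phaseC (ofRealVec p) y) := by
    intro p hp
    rw [← Finset.sum_div]
    simp_rw [← finePt_succ]
    rw [sum_Gfull_finePt (n + 1) (by omega) a y p hp, ← mul_assoc, mul_div_assoc,
      div_self (symbQGQ_ne_zero n ha p hp), mul_one]
  rw [latticeKernel_congr (G1 := fun P => ∑ j : Fin d → Fin (n + 1), Gfull (n + 1) a 0 (chart n y j) P / symbQGQ (n + 1) a P)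
    (G2 := fun P => (((n + 1 : ℕ) : ℂ) ^ d) * cexp (I * phaseC P y)) h2, latticeKernel_const_mul, latticeKernel_phase]
  congr 1
  by_cases hy : y = y₀
  · rw [if_pos hy, if_pos (by rw [hy, neg_add_cancel])]
  · rw [if_neg hy, if_neg (fun h => hy (neg_add_eq_zero.mp h).symm)]

/-! ## §4. The weak Euler–Lagrange equation: `−Δ^ξφ` is block-constant -/

/-- `negLap` is linear over a `z`-independent divisor. [folklore] -/
theorem negLap_div_const (N : ℕ) (f : X d → ℂ) (c : ℂ) (r : X d) :
    negLap N (fun z => f z / c) r = negLap N f r / c := by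
  unfold negLap
  rw [mul_div_assoc, Finset.sum_div]
  congr 1
  exact Finset.sum_congr rfl fun μ _ => by ring

/-- **`−Δ^ξ` of the candidate field**: `(−Δ^ξφ)(r) = latticeKernel ((1 − a·symbQGQ)∕symbQGQ) (blk r − y₀)` — on the zone
`−Δ^ξ Gfull(·;p′)(r) = e^{ip′·⌊r∕N⌋}(1 − a·symbQGQ(p′))` (`opD_Gfull` minus the `aQ*Q` part `sum_Gfull_finePt`), so the
multiplier of `−Δ^ξφ` is a pure block phase times a function of `p′`. [folklore] -/
theorem negLap_phi (n : ℕ) {a : ℝ} (ha : 0 < a) (y₀ r : X d) :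
    negLap (n + 1) (fun z => latticeKernel (fun P => Gfull (n + 1) a 0 z P / symbQGQ (n + 1) a P) (-y₀)) r
      = latticeKernel (fun P => (1 - a * symbQGQ (n + 1) a P) / symbQGQ (n + 1) a P) (blk n r - y₀) := by
  have hN : 1 ≤ n + 1 := by omega
  have hN0 : (((n + 1 : ℕ) : ℂ) ^ d) ≠ 0 := pow_ne_zero _ (Nat.cast_ne_zero.mpr (Nat.succ_ne_zero n))
  have hint : ∀ z', IntegrableOn (integrand (fun P => Gfull (n + 1) a 0 z' P / symbQGQ (n + 1) a P) (-y₀)) (BZ d) :=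
    fun z' => integrableOn_integrand_of_continuousOn (continuousOn_Gfull_div n ha z') _
  have h0 : negLap (n + 1) (fun z => latticeKernel (fun P => Gfull (n + 1) a 0 z P / symbQGQ (n + 1) a P) (-y₀)) r
      = opD (n + 1) 0 0 (fun z => latticeKernel (fun P => Gfull (n + 1) a 0 z P / symbQGQ (n + 1) a P) (-y₀)) r := by
    simp [opD]
  rw [h0, opD_latticeKernel (n + 1) 0 0 _ (-y₀) hint r]
  have h2 : ∀ p ∈ BZ d, opD (n + 1) 0 0 (fun z' => Gfull (n + 1) a 0 z' (ofRealVec p) / symbQGQ (n + 1) a (ofRealVec p)) r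
      = cexp (I * phaseC (ofRealVec p) (blk n r))
        * ((1 - a * symbQGQ (n + 1) a (ofRealVec p)) / symbQGQ (n + 1) a (ofRealVec p)) := by
    intro p hp
    have hs : symbQGQ (n + 1) a (ofRealVec p) ≠ 0 := symbQGQ_ne_zero n ha p hp
    have hD : opD (n + 1) 0 0 (fun z' => Gfull (n + 1) a 0 z' (ofRealVec p) / symbQGQ (n + 1) a (ofRealVec p)) r
        = negLap (n + 1) (fun z' => Gfull (n + 1) a 0 z' (ofRealVec p)) r / symbQGQ (n + 1) a (ofRealVec p) := by
      simp [opD, negLap_div_const]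
    have hL : negLap (n + 1) (fun z' => Gfull (n + 1) a 0 z' (ofRealVec p)) r
        = opD (n + 1) a 0 (fun z' => Gfull (n + 1) a 0 z' (ofRealVec p)) r
          - a * blockAvg (n + 1) (fun z' => Gfull (n + 1) a 0 z' (ofRealVec p)) r := by
      simp [opD]
    have hQ : blockAvg (n + 1) (fun z' => Gfull (n + 1) a 0 z' (ofRealVec p)) r
        = cexp (I * phaseC (ofRealVec p) (blk n r)) * symbQGQ (n + 1) a (ofRealVec p) := by
      unfold blockAvg
      rw [sum_Gfull_finePt (n + 1) hN a (coarse (n + 1) r) p hp, ← mul_assoc, inv_mul_cancel₀ hN0, one_mul, coarse_succ]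
    rw [hD, hL, hQ, opD_Gfull (n + 1) hN a 0 ha le_rfl r p hp, coarse_succ, div_eq_mul_inv, div_eq_mul_inv]
    ring
  rw [latticeKernel_congr
    (G1 := fun P => opD (n + 1) 0 0 (fun z' => Gfull (n + 1) a 0 z' P / symbQGQ (n + 1) a P) r)
    (G2 := fun P => cexp (I * phaseC P (blk n r)) * ((1 - a * symbQGQ (n + 1) a P) / symbQGQ (n + 1) a P)) h2,
    latticeKernel_phase_mul, neg_add_eq_sub]

/-- the stencil sum `Σ_μ(2φ(r) − φ(r+e_μ) − φ(r−e_μ))` of a complex field has real part `lapRow (re ∘ φ)`. [folklore] -/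
theorem lapRow_re (φ : X d → ℂ) (r : X d) :
    lapRow (fun z => (φ z).re) r = (∑ μ, (2 * φ r - φ (r + e μ) - φ (r - e μ))).re := by
  unfold lapRow
  rw [Complex.re_sum]
  refine Finset.sum_congr rfl fun μ _ => ?_
  simp [Complex.sub_re, Complex.mul_re]

/-- the same for the imaginary part. [folklore] -/
theorem lapRow_im (φ : X d → ℂ) (r : X d) :
    lapRow (fun z => (φ z).im) r = (∑ μ, (2 * φ r - φ (r + e μ) - φ (r - e μ))).im := by
  unfold lapRow
  rw [Complex.im_sum]
  refine Finset.sum_congr rfl fun μ _ => ?_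
  simp [Complex.sub_im, Complex.mul_im]

/-- the weak Euler–Lagrange pairing of a test field with ANY fine field reduces to `Σ_{r∈S} A′(r)·(n+1)²·lapRow K r`. [folklore] -/
theorem weakEL_sum_eq (n : ℕ) (S : Finset (X d)) (A' : X d → ℝ) (K : X d → ℝ) :
    ∑' p, (∑ r ∈ S, ((n : ℝ) + 1) ^ 2 * B6QGQLower276.lapKer p r * A' r) * K p
      = ∑ r ∈ S, ((n : ℝ) + 1) ^ 2 * A' r * lapRow K r := by
  have hs : ∀ r, Summable fun p => B6QGQLower276.lapKer p r * K p := fun r => summable_lapKer_mul n r K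
  calc ∑' p, (∑ r ∈ S, ((n : ℝ) + 1) ^ 2 * B6QGQLower276.lapKer p r * A' r) * K p
      = ∑' p, ∑ r ∈ S, ((n : ℝ) + 1) ^ 2 * A' r * (B6QGQLower276.lapKer p r * K p) := by
        refine tsum_congr fun p => ?_
        rw [Finset.sum_mul]
        exact Finset.sum_congr rfl fun r _ => by ring
    _ = ∑ r ∈ S, ∑' p, ((n : ℝ) + 1) ^ 2 * A' r * (B6QGQLower276.lapKer p r * K p) :=
        Summable.tsum_finsetSum fun r _ => (hs r).mul_left _
    _ = ∑ r ∈ S, ((n : ℝ) + 1) ^ 2 * A' r * lapRow K r := by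
        refine Finset.sum_congr rfl fun r _ => ?_
        rw [tsum_mul_left, tsum_lapKer_mul' r K]

/-- `(n+1)²·Σ_μ(2φ(r) − φ(r+e_μ) − φ(r−e_μ)) = negLap (n+1) φ r`. [folklore] -/
theorem negLap_eq (n : ℕ) (φ : X d → ℂ) (r : X d) :
    negLap (n + 1) φ r = ((((n : ℝ) + 1) ^ 2 : ℝ) : ℂ) * ∑ μ, (2 * φ r - φ (r + e μ) - φ (r - e μ)) := by
  unfold negLap
  push_cast
  rfl

/-- a block-constant weight pairs to zero against a block-mean-zero test field (complex values). [folklore] -/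
theorem sum_mul_blockConst_eq_zero_complex {n : ℕ} (S : Finset (X d)) (A' : X d → ℝ) (hS : ∀ r ∉ S, A' r = 0)
    (hQ : ∀ y'' : X d, ∑ r ∈ B n y'', A' r = 0) (ψ : X d → ℂ) :
    ∑ p ∈ S, (A' p : ℂ) * ψ (blk n p) = 0 := by
  apply Complex.ext
  · rw [Complex.re_sum, Complex.zero_re]
    simp_rw [Complex.re_ofReal_mul]
    exact sum_mul_blockConst_eq_zero S A' hS hQ fun y => (ψ y).re
  · rw [Complex.im_sum, Complex.zero_im]
    simp_rw [Complex.im_ofReal_mul]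
    exact sum_mul_blockConst_eq_zero S A' hS hQ fun y => (ψ y).im

/-- **the test pairing vanishes (complex form)**: `Σ_{r∈S} A′(r)·(−Δ^ξφ)(r) = 0` for every finitely supported block-mean-zero `A′`.
[folklore] -/
theorem sum_mul_negLap_phi (n : ℕ) {a : ℝ} (ha : 0 < a) (y₀ : X d) (S : Finset (X d)) (A' : X d → ℝ)
    (hS : ∀ r ∉ S, A' r = 0) (hQ : ∀ y'' : X d, ∑ r ∈ B n y'', A' r = 0) :
    ∑ r ∈ S, (A' r : ℂ) *
      negLap (n + 1) (fun z => latticeKernel (fun P => Gfull (n + 1) a 0 z P / symbQGQ (n + 1) a P) (-y₀)) r = 0 := by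
  simp_rw [negLap_phi n ha y₀]
  have h : ∀ r : X d, blk n r - y₀ = -y₀ + blk n r := fun r => by rw [neg_add_eq_sub]
  simp_rw [h]
  exact sum_mul_blockConst_eq_zero_complex S A' hS hQ fun y =>
    latticeKernel (fun P => (1 - a * symbQGQ (n + 1) a P) / symbQGQ (n + 1) a P) (-y₀ + y)

/-- **the real part of the candidate field satisfies the weak Euler–Lagrange equation.** [folklore] -/
theorem weakEL_phi_re (n : ℕ) {a : ℝ} (ha : 0 < a) (y₀ : X d) :
    WeakEL n fun z => (latticeKernel (fun P => Gfull (n + 1) a 0 z P / symbQGQ (n + 1) a P) (-y₀)).re := by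
  intro S A' hS hQ
  rw [weakEL_sum_eq]
  have h := congrArg Complex.re (sum_mul_negLap_phi n ha y₀ S A' hS hQ)
  rw [Complex.re_sum, Complex.zero_re] at h
  refine Eq.trans (Finset.sum_congr rfl fun r _ => ?_) h
  rw [negLap_eq, lapRow_re, Complex.re_ofReal_mul, Complex.re_ofReal_mul]
  ring

/-- **the imaginary part of the candidate field satisfies the weak Euler–Lagrange equation.** [folklore] -/
theorem weakEL_phi_im (n : ℕ) {a : ℝ} (ha : 0 < a) (y₀ : X d) :
    WeakEL n fun z => (latticeKernel (fun P => Gfull (n + 1) a 0 z P / symbQGQ (n + 1) a P) (-y₀)).im := by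
  intro S A' hS hQ
  rw [weakEL_sum_eq]
  have h := congrArg Complex.im (sum_mul_negLap_phi n ha y₀ S A' hS hQ)
  rw [Complex.im_sum, Complex.zero_im] at h
  refine Eq.trans (Finset.sum_congr rfl fun r _ => ?_) h
  rw [negLap_eq, lapRow_im, Complex.im_ofReal_mul, Complex.im_ofReal_mul]
  ring

/-! ## §5. The identification with the column's `H` -/

/-- `H` applied to the lattice delta `δ_{y₀}` is the column `H(·, y₀)`. [folklore] -/
theorem HBZd_delta (n : ℕ) (a : ℝ) (y₀ z : X d) :
    HBZd n a (fun y => if y = y₀ then (1 : ℝ) else 0) z = kerH n a z y₀ := by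
  unfold HBZd
  rw [tsum_eq_single y₀ (fun y hy => by simp [hy])]
  simp

/-- the real part of the candidate field IS `H(·, y₀)` (uniqueness of the square-summable weak solution,
`B5Hk165L2Zd.eq_HBZd_of_weakEL`). [folklore] -/
theorem phi_re_eq_kerH (n : ℕ) {a : ℝ} (ha : 0 < a) (y₀ z : X d) :
    (latticeKernel (fun P => Gfull (n + 1) a 0 z P / symbQGQ (n + 1) a P) (-y₀)).re = kerH n a z y₀ := by
  have hB : Summable fun y : X d => (if y = y₀ then (1 : ℝ) else 0) ^ 2 :=
    summable_of_ne_finset_zero (s := {y₀}) fun y hy => by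
      rw [Finset.mem_singleton] at hy; rw [if_neg hy]; norm_num
  have hKQ : ∀ y'' : X d, ∑ p ∈ B n y'',
      (latticeKernel (fun P => Gfull (n + 1) a 0 p P / symbQGQ (n + 1) a P) (-y₀)).re
        = ((n : ℝ) + 1) ^ d * (if y'' = y₀ then (1 : ℝ) else 0) := by
    intro y''
    have hc : (((n + 1 : ℕ) : ℂ) ^ d) = ((((n : ℝ) + 1) ^ d : ℝ) : ℂ) := by push_cast; ring
    rw [← Complex.re_sum, sum_B_phi n ha y₀ y'', hc]
    by_cases hy : y'' = y₀
    · rw [if_pos hy, if_pos hy, mul_one, mul_one, Complex.ofReal_re]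
    · rw [if_neg hy, if_neg hy, mul_zero, mul_zero, Complex.zero_re]
  have h := eq_HBZd_of_weakEL n ha hB _ (summable_sq_phi_re n ha y₀) hKQ (weakEL_phi_re n ha y₀)
  have hz := congrFun h z
  rw [HBZd_delta] at hz
  exact hz

/-- the imaginary part of the candidate field vanishes (the same uniqueness with `B = 0`). [folklore] -/
theorem phi_im_eq_zero (n : ℕ) {a : ℝ} (ha : 0 < a) (y₀ z : X d) :
    (latticeKernel (fun P => Gfull (n + 1) a 0 z P / symbQGQ (n + 1) a P) (-y₀)).im = 0 := by
  have hB : Summable fun _y : X d => (0 : ℝ) ^ 2 := by simp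
  have hKQ : ∀ y'' : X d, ∑ p ∈ B n y'',
      (latticeKernel (fun P => Gfull (n + 1) a 0 p P / symbQGQ (n + 1) a P) (-y₀)).im
        = ((n : ℝ) + 1) ^ d * (0 : ℝ) := by
    intro y''
    have hc : (((n + 1 : ℕ) : ℂ) ^ d) = ((((n : ℝ) + 1) ^ d : ℝ) : ℂ) := by push_cast; ring
    rw [← Complex.im_sum, sum_B_phi n ha y₀ y'', hc]
    by_cases hy : y'' = y₀
    · rw [if_pos hy, mul_one, mul_zero, Complex.ofReal_im]
    · rw [if_neg hy, mul_zero, mul_zero, Complex.zero_im]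
  have h := eq_HBZd_of_weakEL n ha hB _ (summable_sq_phi_im n ha y₀) hKQ (weakEL_phi_im n ha y₀)
  have hz := congrFun h z
  rw [hz]
  simp [HBZd]

/-- **THE HEADLINE — [B5] (1.103) IN FOURIER FORM ON `ℤ^d` (scalar column)**: for every `n` (block side `n+1 = L^j`), every `a > 0`,
every fine site `z ∈ ℤ^d` and block `y₀ ∈ ℤ^d`,
`H(z, y₀) = (2π)^{−d} ∫_{[−π,π]^d} Gfull(z;p′) e^{−ip′·y₀} ∕ (Q′G′Q′*)~(p′) dp′`,
where `H = kerH n a` is the pv23 kernel of `G′Q′*(Q′G′Q′*)⁻¹` (`B5Hk103ScalarZd`), `Gfull` the full (2.48) multiplier of `G′Q′*`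
(`B4Green244`) and `(Q′G′Q′*)~ = symbQGQ` the (2.75) multiplier (`B6QGQFourier275Zd`) — the momentum representation behind print's
«Using (1.60), or better (1.63), we can verify all the properties of H_kB» read for the scalar whole-lattice objects. [folklore] -/
theorem kerH_eq_latticeKernel (n : ℕ) {a : ℝ} (ha : 0 < a) (z y₀ : X d) :
    (kerH n a z y₀ : ℂ) = latticeKernel (fun P => Gfull (n + 1) a 0 z P / symbQGQ (n + 1) a P) (-y₀) := by
  apply Complex.ext
  · rw [Complex.ofReal_re, phi_re_eq_kerH n ha]
  · rw [Complex.ofReal_im, phi_im_eq_zero n ha]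

/-- **THE ALIAS ∕ OFFSET FORM**: at the fine site `chart n x τ` (block `x`, offset `τ`),
`H(chart n x τ, y₀) = (2π)^{−d} ∫ G_{n+1,a,0,τ}(p′) e^{ip′·(x−y₀)} ∕ (Q′G′Q′*)~(p′) dp′` with the block-offset multiplier
`G_τ = Σ_k e^{i(p′+2πk)·τ∕N} u(p′+2πk)R_k∕E` of (2.48) — block row by block row `H(·,y₀)` is the Fourier-coefficient sequence of the
continuous zone function `G_τ∕symbQGQ`. [folklore] -/
theorem kerH_chart_eq_latticeKernel (n : ℕ) {a : ℝ} (ha : 0 < a) (x y₀ : X d) (τ : Fin d → Fin (n + 1)) :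
    (kerH n a (chart n x τ) y₀ : ℂ) = latticeKernel (fun P => G (n + 1) a 0 τ P / symbQGQ (n + 1) a P) (x - y₀) := by
  rw [kerH_eq_latticeKernel n ha, phi_chart]

end

end Summit.QuantumFields.BalabanUV.T4Continuum.NE7b.OneShotChartFourier
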